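import Literature.AlgebraicGeometry.HodgeTheory.KunnethComponentsDiagonalAction
import Literature.AlgebraicGeometry.HodgeTheory.ComplexGysinCorrespondence
import Literature.AlgebraicGeometry.HodgeTheory.AbelianVarietyMultiplicationPullback
import Literature.AlgebraicGeometry.HodgeTheory.MotivatedClassesAlgebraic
import Literature.AlgebraicGeometry.HodgeTheory.ComplexOrientationFamily
import Mathlib.LinearAlgebra.Vandermonde
import Mathlib.LinearAlgebra.Matrix.NonsingularInverse
import HarnessLib

/-!
# The Künneth standard conjecture `C(A)` for complex abelian varieties: every Künneth component of the diagonal is algebraic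

Family `hodge`, layer `Literature/AlgebraicGeometry/HodgeTheory`; lane `lit-hodgefound`. THEOREMS ONLY
(no definition, no named fact; D-0026). Seventh part of the story `KunnethComponentsOfHodgeClasses` / … /
`KunnethStandardConjectureHypersurfaces` on the carriers `kunnethPiece`, `algebraicClasses`, `corrAction`
and the Künneth families `π : Fin (2g+1) → H^{2g}((A ⊗ A)(ℂ); ℂ)` of `cl(Δ_A) = diagonalClass hA`.

For a complex abelian variety `A` of dimension `g` the graph `Γ_{[n]}` of multiplication by `n` is an
algebraic cycle on `A × A` whose class acts on `Hᵃ(A(ℂ); ℂ) = ⋀ᵃ H¹` as `[n]^* = nᵃ` (Mumford §1 (3), §19;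
the tree's `complexBetti_map_nsmul_id_apply`, `corrClassAction_graph`,
`complexGysin_graph_one_mem_algebraicClasses`). Since the Vandermonde matrix of the `2g + 1` nodes
`0, 1, …, 2g` is invertible, suitable combinations `p_k = Σ_n c_{k,n} [Γ_{[n]}]` act as `δ_{ak}` on `Hᵃ`
(`a ≤ 2g`) — Kleiman's proof of `C(A)` (1968 §2 Appendix / 1994 4.1; Voisin 2025 §3.2.1: "`C(X)` is
known for abelian varieties"). By the characterisation of Künneth components through their action
(`eq_kunnethComponent_diagonalClass_of_corrAction`, file `KunnethComponentsDiagonalAction`), `p_{2g−i}`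
IS the component `πⁱ ∈ H^{2g−i} ⊗ Hⁱ` of EVERY Künneth decomposition of `cl(Δ_A)`; so every Künneth
component is algebraic. (The Summits tree has the projector statement §3 under
`Summit.HodgeConjecture.HodgeConjecture.Ring2.AbelianAll.exists_kunnethProjector_abelianVariety`, not
importable from `Literature/`, and the Künneth-family form §4 under
`Summit.HodgeConjecture.HodgeConjecture.Theorems.kunnethComponent_diagonal_mem_algebraicClasses`; the
present file is their Literature home, proved from Literature lemmas only.)

* §1 `exists_sum_mul_natCast_pow_eq_ite` — interpolation `Σ_{n ≤ N} c_n nᵃ = δ_{ak}` (`a ≤ N`) over any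
  field of characteristic zero (Vandermonde).
* §2 `corrAction_gysinGraph_nsmul` — `[Γ_{[n]}]_* = nᵃ · id` on `Hᵃ(A(ℂ); ℂ)`.
* §3 `AbelianVariety.exists_mem_algebraicClasses_corrAction_eq_ite` — an algebraic class acting as `δ_{ak}`.
* §4 **`AbelianVariety.kunnethComponent_diagonalClass_mem_algebraicClasses`** — `C(A)`: every Künneth
  component of every Künneth decomposition of `cl(Δ_A)` is algebraic;
  `AbelianVariety.exists_kunnethComponents_diagonalClass_mem_algebraicClasses`.

## References

* [Kleiman1968AlgebraicCycles] S. Kleiman, Algebraic cycles and the Weil conjectures, in: Dix exposés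
  (1968), §2 and Appendix to §2 (2A11: `C(X)` for abelian varieties).
* [Kleiman1994] S. Kleiman, The standard conjectures, Proc. Symp. Pure Math. 55.1 (1994), 4.1.
* [MumfordAV1970] D. Mumford, Abelian Varieties (1970), §1 (3), §19.
* [Voisin2025] C. Voisin, Hodge and generalized Hodge conjectures, coniveau and algebraic cycles,
  J. Open Math. Probl. 1 (2025), §3.2.1 (14) and the paragraph after it.
-/

noncomputable section

open CategoryTheory AlgebraicGeometry MonoidalCategory CartesianMonoidalCategory Finset
open Literature.AlgebraicTopology.SingularHomology
open Literature.AlgebraicGeometry.Motives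

namespace Literature.AlgebraicGeometry.HodgeTheory

universe u

/-! ### §1 The Vandermonde system `Σ_n c_n nᵃ = δ_{ak}` -/

/-- **Interpolation of `δ_{·k}` on the nodes `0, …, N` by powers**, over a field of characteristic zero:
there are `c₀, …, c_N` with `Σ_{n ≤ N} c_n nᵃ = δ_{ak}` for all `a ≤ N` (the Vandermonde matrix of the
distinct nodes `0, …, N` is invertible). [folklore] [cite: Kleiman1968AlgebraicCycles, Appendix to §2] -/
theorem exists_sum_mul_natCast_pow_eq_ite (K : Type u) [Field K] [CharZero K] (N k : ℕ) :
    ∃ c : Fin (N + 1) → K, ∀ a : ℕ, a ≤ N →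
      ∑ i : Fin (N + 1), c i * ((i : ℕ) : K) ^ a = if a = k then 1 else 0 := by
  classical
  by_cases hk : k ≤ N
  · set v : Fin (N + 1) → K := fun i ↦ ((i : ℕ) : K) with hv
    set V : Matrix (Fin (N + 1)) (Fin (N + 1)) K := (Matrix.vandermonde v).transpose with hV
    have hdet : IsUnit V.det := by
      rw [hV, Matrix.det_transpose, isUnit_iff_ne_zero, Matrix.det_vandermonde_ne_zero_iff]
      intro i j hij
      have h' : ((i : ℕ) : K) = ((j : ℕ) : K) := hij
      exact Fin.ext (Nat.cast_injective h')
    set e : Fin (N + 1) → K := Pi.single (⟨k, by omega⟩ : Fin (N + 1)) 1 with he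
    refine ⟨V⁻¹.mulVec e, fun a ha ↦ ?_⟩
    have hsol : V.mulVec (V⁻¹.mulVec e) = e := by
      rw [Matrix.mulVec_mulVec, Matrix.mul_nonsing_inv _ hdet, Matrix.one_mulVec]
    have hrow := congrFun hsol ⟨a, by omega⟩
    rw [Matrix.mulVec, dotProduct] at hrow
    calc ∑ i : Fin (N + 1), V⁻¹.mulVec e i * ((i : ℕ) : K) ^ a
        = ∑ i : Fin (N + 1), V ⟨a, by omega⟩ i * V⁻¹.mulVec e i := by
          refine Finset.sum_congr rfl fun i _ ↦ ?_
          rw [hV, Matrix.transpose_apply, Matrix.vandermonde_apply, mul_comm]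
      _ = e ⟨a, by omega⟩ := hrow
      _ = if a = k then 1 else 0 := by
          rw [he, Pi.single_apply]
          simp only [Fin.mk.injEq]
  · refine ⟨0, fun a ha ↦ ?_⟩
    have hak : a ≠ k := by omega
    simp [hak]

/-! ### §2 The graph of multiplication by `n` acts as `nᵃ` on `Hᵃ(A(ℂ); ℂ)` -/

/-- **`[Γ_{[n]}]_* = nᵃ · id` on `Hᵃ(A(ℂ); ℂ)`** (`a ≤ 2g`): the graph class of multiplication by `n` on a
complex abelian variety acts as `[n]^*` (`corrClassAction_graph`), and `[n]^* = nᵃ` on `Hᵃ = ⋀ᵃ H¹`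
(`complexBetti_map_nsmul_id_apply`). (Literature home of the Summits-side
`Ring2.AbelianAll.corrAction_graph_nsmul`.) [cite: MumfordAV1970, §1 (3) and §19]
[cite: Kleiman1968AlgebraicCycles, Appendix to §2] -/
theorem corrAction_gysinGraph_nsmul (A : AbelianVariety ℂ) (n a : ℕ) (ha : a ≤ 2 * A.dim) :
    corrAction complexOrientationFamily (AbelianVariety.isSmoothProjective_holds (A := A))
        (AbelianVariety.isSmoothProjective_holds (A := A)) (rfl : a + 2 * A.dim = a + 2 * A.dim)
        (complexGysin complexOrientationFamily (AbelianVariety.isSmoothProjective_holds (A := A))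
          ((AbelianVariety.isSmoothProjective_holds (A := A)).tensor_holds
            (AbelianVariety.isSmoothProjective_holds (A := A)))
          (lift (𝟙 A.X) (n • 𝟙 A).hom.hom.hom) (show 0 + 2 * (A.dim + A.dim) = 2 * A.dim + 2 * A.dim by omega)
          (singularCohomology.one ℂ (ComplexPoints A.X))) =
      (((n : ℂ)) ^ a) • LinearMap.id := by
  have hA : IsSmoothProjective A.dim A.X := AbelianVariety.isSmoothProjective_holds (A := A)
  refine LinearMap.ext fun c ↦ ?_
  rw [corrAction_eq_corrClassAction complexOrientationFamily hA hA rfl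
      (show a + (2 * A.dim - a) = 2 * A.dim by omega),
    corrClassAction_graph complexOrientationFamily hasPoincareDuality_complexOrientationFamily hA
      (hA.tensor_holds hA) (n • 𝟙 A).hom.hom.hom (show a + (2 * A.dim - a) = 2 * A.dim by omega) c,
    LinearMap.smul_apply, LinearMap.id_apply]
  exact complexBetti_map_nsmul_id_apply A n a c

/-! ### §3 An algebraic class acting as `δ_{ak}` -/

/-- **Kleiman's projectors**: for every complex abelian variety `A` of dimension `g` and every `k` there is
an ALGEBRAIC class `p ∈ Nᵍ H^{2g}((A ⊗ A)(ℂ); ℂ)` — `p = Σ_{n ≤ 2g} c_{k,n} [Γ_{[n]}]` with Vandermonde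
coefficients — acting on `Hᵃ(A(ℂ); ℂ)` as `δ_{ak} · id` for every `a ≤ 2g`. (Literature home of the
Summits-side `Ring2.AbelianAll.exists_kunnethProjector_abelianVariety`.)
[cite: Kleiman1968AlgebraicCycles, §2 and Appendix to §2] [cite: Kleiman1994, 4.1] [cite: MumfordAV1970, §19] -/
theorem _root_.Literature.AlgebraicGeometry.Motives.AbelianVariety.exists_mem_algebraicClasses_corrAction_eq_ite
    (A : AbelianVariety ℂ) (k : ℕ) :
    ∃ p ∈ algebraicClasses (A.X ⊗ A.X) A.dim, ∀ a : ℕ, a ≤ 2 * A.dim →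
      corrAction complexOrientationFamily (AbelianVariety.isSmoothProjective_holds (A := A))
        (AbelianVariety.isSmoothProjective_holds (A := A)) (rfl : a + 2 * A.dim = a + 2 * A.dim) p =
      (if a = k then (1 : ℂ) else 0) • LinearMap.id := by
  classical
  have hA : IsSmoothProjective A.dim A.X := AbelianVariety.isSmoothProjective_holds (A := A)
  obtain ⟨c, hc⟩ := exists_sum_mul_natCast_pow_eq_ite ℂ (2 * A.dim) k
  -- the graph classes of `[n]`, `n = 0, …, 2g`
  set Γ : Fin (2 * A.dim + 1) → complexBetti (A.X ⊗ A.X) (2 * A.dim) := fun i ↦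
    complexGysin complexOrientationFamily hA (hA.tensor_holds hA) (lift (𝟙 A.X) ((i : ℕ) • 𝟙 A).hom.hom.hom)
      (show 0 + 2 * (A.dim + A.dim) = 2 * A.dim + 2 * A.dim by omega)
      (singularCohomology.one ℂ (ComplexPoints A.X))
    with hΓ
  refine ⟨∑ i, c i • Γ i, Submodule.sum_mem _ fun i _ ↦ Submodule.smul_mem _ _ ?_, fun a ha ↦ ?_⟩
  · exact complexGysin_graph_one_mem_algebraicClasses complexOrientationFamily
      hasPoincareDuality_complexOrientationFamily hA (hA.tensor_holds hA) _
  · rw [map_sum]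
    simp only [map_smul, hΓ]
    rw [show (∑ i : Fin (2 * A.dim + 1), c i • corrAction complexOrientationFamily hA hA
        (rfl : a + 2 * A.dim = a + 2 * A.dim)
        (complexGysin complexOrientationFamily hA (hA.tensor_holds hA)
          (lift (𝟙 A.X) ((i : ℕ) • 𝟙 A).hom.hom.hom)
          (show 0 + 2 * (A.dim + A.dim) = 2 * A.dim + 2 * A.dim by omega)
          (singularCohomology.one ℂ (ComplexPoints A.X)))) =
        ∑ i : Fin (2 * A.dim + 1), (c i * ((i : ℕ) : ℂ) ^ a) •
          (LinearMap.id : complexBetti A.X a →ₗ[ℂ] complexBetti A.X a)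
      from Finset.sum_congr rfl fun i _ ↦ by rw [corrAction_gysinGraph_nsmul A i a ha, smul_smul]]
    rw [← Finset.sum_smul, hc a ha]

/-! ### §4 `C(A)`: every Künneth component of `cl(Δ_A)` is algebraic -/

/-- **THE KÜNNETH STANDARD CONJECTURE FOR COMPLEX ABELIAN VARIETIES.** For every complex abelian variety
`A` of dimension `g` and EVERY Künneth decomposition `cl(Δ_A) = Σᵢ πⁱ`, `πⁱ ∈ H^{2g−i}(A) ⊗ Hⁱ(A)`, every
component `πⁱ` is algebraic: Kleiman's algebraic class `p_{2g−i}` (§3) acts as the identity on `H^{2g−i}`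
and as zero in every other degree, which characterises `πⁱ` (`eq_kunnethComponent_diagonalClass_of_corrAction`).
(Literature copy of the Summits-side `Summit.HodgeConjecture.HodgeConjecture.Theorems.kunnethComponent_diagonal_mem_algebraicClasses`,
not importable from `Literature/`.) [cite: Kleiman1968AlgebraicCycles, §2 and Appendix to §2] [cite: Kleiman1994, 4.1]
[cite: Voisin2025, §3.2.1 (14)] -/
theorem _root_.Literature.AlgebraicGeometry.Motives.AbelianVariety.kunnethComponent_diagonalClass_mem_algebraicClasses
    (A : AbelianVariety ℂ)
    {π : Fin (2 * A.dim + 1) → complexBetti (A.X ⊗ A.X) (2 * A.dim)}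
    (hπ : ∀ i : Fin (2 * A.dim + 1), π i ∈ kunnethPiece A.X A.X
      (show (2 * A.dim - (i : ℕ)) + i = 2 * A.dim by omega))
    (hΔ : ∑ i, π i = diagonalClass (AbelianVariety.isSmoothProjective_holds (A := A)))
    (i : Fin (2 * A.dim + 1)) :
    π i ∈ algebraicClasses (A.X ⊗ A.X) A.dim := by
  have hA : IsSmoothProjective A.dim A.X := AbelianVariety.isSmoothProjective_holds (A := A)
  obtain ⟨p, hp, hact⟩ := A.exists_mem_algebraicClasses_corrAction_eq_ite (2 * A.dim - (i : ℕ))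
  have hi := i.isLt
  have hpπ : p = π i := by
    refine eq_kunnethComponent_diagonalClass_of_corrAction hA hπ hΔ i (fun a hab ha ↦ ?_)
      (fun a hab ha ↦ ?_)
    · rw [hact a (by omega), if_pos (by omega), one_smul]
    · by_cases ha' : a ≤ 2 * A.dim
      · rw [hact a ha', if_neg (by omega), zero_smul]
      · haveI := subsingleton_complexBetti hA (show 2 * A.dim < a by omega)
        exact LinearMap.ext fun u ↦ Subsingleton.elim _ _
  rw [← hpπ]
  exact hp

/-- **`C(A)`, existence form**: a complex abelian variety has a Künneth decomposition of `cl(Δ_A)` all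
of whose components are algebraic (any Künneth decomposition — `nonempty_kunnethComponents_diagonalClass` —
will do, by the previous theorem). [cite: Kleiman1968AlgebraicCycles, §2 and Appendix to §2] [cite: Kleiman1994, 4.1] -/
theorem _root_.Literature.AlgebraicGeometry.Motives.AbelianVariety.exists_kunnethComponents_diagonalClass_mem_algebraicClasses
    (A : AbelianVariety ℂ) :
    ∃ π : Fin (2 * A.dim + 1) → complexBetti (A.X ⊗ A.X) (2 * A.dim),
      (∀ i : Fin (2 * A.dim + 1), π i ∈ kunnethPiece A.X A.X
        (show (2 * A.dim - (i : ℕ)) + i = 2 * A.dim by omega)) ∧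
      ∑ i, π i = diagonalClass (AbelianVariety.isSmoothProjective_holds (A := A)) ∧
      ∀ i : Fin (2 * A.dim + 1), π i ∈ algebraicClasses (A.X ⊗ A.X) A.dim := by
  obtain ⟨⟨π, hπ, hΔ⟩⟩ :=
    nonempty_kunnethComponents_diagonalClass (AbelianVariety.isSmoothProjective_holds (A := A))
  exact ⟨π, hπ, hΔ, A.kunnethComponent_diagonalClass_mem_algebraicClasses hπ hΔ⟩

/-- **The Künneth components of `cl(Δ_A)` act through algebraic classes in each degree**: for every
`a ≤ 2g` there is an algebraic class acting as the identity on `Hᵃ(A(ℂ); ℂ)` and as zero on `Hᵇ`,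
`b ≠ a` — namely the Künneth component `π^{2g−a}` of any Künneth decomposition.
[cite: Kleiman1994, 4.1] [cite: Voisin2025, §3.2.1 (14)] -/
theorem _root_.Literature.AlgebraicGeometry.Motives.AbelianVariety.corrAction_kunnethComponent_diagonalClass
    (A : AbelianVariety ℂ)
    {π : Fin (2 * A.dim + 1) → complexBetti (A.X ⊗ A.X) (2 * A.dim)}
    (hπ : ∀ i : Fin (2 * A.dim + 1), π i ∈ kunnethPiece A.X A.X
      (show (2 * A.dim - (i : ℕ)) + i = 2 * A.dim by omega))
    (hΔ : ∑ i, π i = diagonalClass (AbelianVariety.isSmoothProjective_holds (A := A)))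
    (i : Fin (2 * A.dim + 1)) (a : ℕ) :
    π i ∈ algebraicClasses (A.X ⊗ A.X) A.dim ∧
      corrAction complexOrientationFamily (AbelianVariety.isSmoothProjective_holds (A := A))
        (AbelianVariety.isSmoothProjective_holds (A := A)) (rfl : a + 2 * A.dim = a + 2 * A.dim) (π i) =
      (if a + i = 2 * A.dim then (1 : ℂ) else 0) • LinearMap.id := by
  refine ⟨A.kunnethComponent_diagonalClass_mem_algebraicClasses hπ hΔ i, ?_⟩
  split_ifs with ha
  · rw [one_smul]
    exact corrAction_kunnethComponent_diagonalClass_of_add_eq _ hπ hΔ i rfl ha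
  · rw [zero_smul]
    exact corrAction_kunnethComponent_diagonalClass_of_add_ne _ _ hπ i rfl ha

end Literature.AlgebraicGeometry.HodgeTheory

end
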